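import Literature.Analysis.FluidPDE.NSEssEndpointLocalHolder
import Literature.Analysis.FluidPDE.ESSLocalHolderCovering
import HarnessLib

/-!
# ESS (3.5)–(3.6) without the Hölder upgrade: `ess_sup_bound` (and ns.S08) from the absence of
# points of concentration alone

Analysis/FluidPDE proofs-only file (theorems only: no definitions, no named facts, no statement
changed) on the discharge path of the named fact `Literature.Analysis.FluidPDE.ess_sup_bound`
(`NSLerayHopfProofs.lean`; L. Escauriaza, G. Seregin, V. Šverák, *`L_{3,∞}`-solutions of
Navier–Stokes equations and backward uniqueness*, Russ. Math. Surveys 58:2 (2003) 211–250, §3,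
(3.5)–(3.6): a Leray–Hopf solution of the Cauchy problem on `ℝ³ × [0, T)` lying in
`L_{3,∞}(Q_T)` is bounded on `ℝ³ × [δ, T]` for every `δ > 0`).

## What is here and why

The accepted reduction `ess_sup_bound_of_local_holder` (`NSEssEndpointReduced.lean`) proves
`ess_sup_bound` from ESS Thm. 1.4 (`ess_local_holder`: `L_{3,∞}` suitable pairs on `Q(1)` are
**Hölder continuous** on `Q̄(1/2)`), the ε-regularity criterion and the associated pressure being
theorems (`lemarieRieusset_epsilon_regularity_holds`, `ess_associated_pressure_holds`). The
bottom-up discharge of Thm. 1.4 in the tree (`ESSLocalHolderCovering.lean` and its sequels)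
splits it as `ess_local_holder_of_epsilonRegularity_of_noConcentration`:

* (NC) **no point of `Q̄(1/2)` is a point of `ε`-concentration** of `|v|³ + |p|^{3/2}` for a pair
  with (1.15)–(1.16) on `Q(1)` — the content of the blow-up / backward-uniqueness / unique-
  continuation argument of ESS §3, (3.8)–(3.35); and
* ESS Lemma 2.2 in its Hölder form `ess_epsilon_regularity'` (Hölder continuity up to the closed
  half cylinder with a uniform sup bound), whose discharge requires the quantitative higher
  regularity of bounded solutions (`NSBoundedHigherRegularityBounds`) or the linear Stokes
  estimates (`StokesLocalW21Estimate`, `StokesLocalHolderBound`), none of them proved yet.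

For (3.6), however, Hölder continuity is never used: the printed argument ("for any
`z₀ ∈ ℝ³ × ]0, T]` there is `R > 0` such that `v` is Hölder continuous in `Q̄(z₀, R)` […] Using
scaling arguments, Lemma 2.2 and statement (3.5), we observe that `max_{ℝ³ × [δ,T]} |v| < C₁(δ)`",
ESS §3) only needs `v` **essentially bounded near every point** of `ℝ³ × [δ, T]`, and at a point
which is not a point of concentration this is the *boundedness* form of ε-regularity
(Caffarelli–Kohn–Nirenberg, Prop. 1; Lemarié-Rieusset 2016, Thm. 14.4; Robinson–Rodrigo–Sadowski
2016, Thm. 15.3), which IS a theorem of the tree (`lemarieRieusset_epsilon_regularity_holds`,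
used through the accepted rescaled bound `ess_epsilon_bound_scaled_LR`). This file proves the
corresponding reduction:

* `ess_sup_bound_of_nearBound_scaled` — Steps 2–4 of the accepted `ess_sup_bound_of_scaled`
  (near field by compactness of `[δ, T] × B̄(0, ρ₀)`, far field by the tails of
  `∫∫_{Q_T} (|u|³ + |p|^{3/2})`, Fubini) with the near-field a.e. bound on half cylinders taken as
  a hypothesis instead of being derived from `ess_local_holder` (same proof);
* `exists_ae_bound_half_of_forall_small` — the unit picture: if `(v, p)` satisfies (1.15)–(1.16)
  on `Q(1)` and the ε-regularity quantity is small at some scale around **every** point of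
  `Q̄(1/2)`, then `v` is essentially bounded on `Q(1/2)` (the covering step of
  `ESSLocalHolderCovering.exists_holder_of_forall_small` with bounded pieces in place of Hölder
  pieces: interior apexes are shifted up by `exists_shift_apex_small`, top apexes carry their own
  piece, finitely many pieces suffice);
* `IsL3inftyLocalPair.exists_ae_bound_of_noConcentration` — the rescaled statement on viscous
  cylinders `Q_ν(z₀, R)` (transport along the parabolic dilation, as in the accepted
  `IsL3inftyLocalPair.exists_ae_bound`);
* `ess_sup_bound_of_noConcentration` — **`ess_sup_bound` follows from (NC) alone**, (NC) being
  stated verbatim as the hypothesis `hno` of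
  `ess_local_holder_of_epsilonRegularity_of_noConcentration`;
* `ess_L5_integrability_of_noConcentration`, `ess_endpoint_of_noConcentration` — hence so do
  ESS (1.14) and the endpoint criterion **ns.S08** (`ess_endpoint`), through the accepted
  `ess_L5_integrability_of_sup_bound`, `ess_endpoint_of_sup_bound_of_kato` and the theorems
  `ess_kato_L3_local_holds`, `galdi_energy_equality_holds`, `ladyzhenskaya_prodi_serrin_holds`.

So the single open leaf under `ess_sup_bound`, `ess_L5_integrability` and ns.S08 is (NC); the
Hölder form of Lemma 2.2 is needed only for the Hölder conclusion of Thm. 1.4 itself. Nothing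
accepted is restated or changed; no `sorry`.

## References

* L. Escauriaza, G. Seregin, V. Šverák, Russ. Math. Surveys 58:2 (2003) 211–250: Thm. 1.3, its
  proof in §3 ((3.2)–(3.6)), Thm. 1.4, Lemma 2.2. [`EscauriazaSereginSverak2003`]
* G. Seregin, *Lecture Notes on Regularity Theory for the Navier–Stokes Equations*, World
  Scientific (2014), §6.6, Prop. 6.20, Thm. 6.21, pp. 126–129. [`Seregin2014`]
* P. G. Lemarié-Rieusset, *The Navier–Stokes Problem in the 21st Century*, CRC Press (2016),
  Thm. 14.4, p. 505. [`LemarieRieusset2016`]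
* J. C. Robinson, J. L. Rodrigo, W. Sadowski, *The Three-Dimensional Navier–Stokes Equations*,
  CUP (2016), Thm. 15.3, Thm. 16.4 and §16.4. [`RobinsonRodrigoSadowski2016`]
-/

noncomputable section

open MeasureTheory TopologicalSpace Set Function Filter Topology Metric Module
open scoped InnerProductSpace RealInnerProductSpace ENNReal NNReal

namespace Literature.Analysis.FluidPDE


/-! ### Steps 2–4 of ESS (3.5)–(3.6) with the near-field bound as a hypothesis -/

/-- **ESS (3.6) from a near-field bound, the rescaled ε-regularity bound and the associated
pressure** (Escauriaza–Seregin–Šverák 2003, §3, proof of Thm. 1.3, (3.5)–(3.6)). The accepted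
`ess_sup_bound_of_scaled` with its only use of Thm. 1.4 — "`u` is essentially bounded on
`Q_ν(z₀, R/2)` whenever `(u, p)` satisfies (1.15)–(1.16) on `Q_ν(z₀, R)`"
(`IsL3inftyLocalPair.exists_ae_bound hLH`) — taken as the hypothesis `hnear`; the proof is
otherwise that of `ess_sup_bound_of_scaled` (near field: the cylinders `Q_ν(z₀, √(νδ/2))`,
`t₀ ∈ [δ, T]`, and compactness of `[δ, T] × B̄(0, ρ₀)`; far field: the tails of
`∫∫_{Q_T} (|u|³ + |p|^{3/2})` and the rescaled ε-regularity bound `hsc`; Fubini). Real proof.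
[cite: EscauriazaSereginSverak2003, §3 (3.5)–(3.6)] -/
theorem ess_sup_bound_of_nearBound_scaled
    (hnear : ∀ {ν R t₀ : ℝ} {x₀ : EuclideanSpace ℝ (Fin 3)} {u : ℝ → EuclideanSpace ℝ (Fin 3) → EuclideanSpace ℝ (Fin 3)} {p : ℝ → EuclideanSpace ℝ (Fin 3) → ℝ},
      0 < ν → 0 < R → IsL3inftyLocalPair ν R (t₀, x₀) u p →
      ∃ M : ℝ, ∀ᵐ z ∂(volume.restrict (viscousCylinder ν (R / 2) (t₀, x₀))), ‖u z.1 z.2‖ ≤ M)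
    (hsc : ∃ ε₀ c₀ : ℝ, 0 < ε₀ ∧ 0 < c₀ ∧ ∀ {ν R t₀ : ℝ} {x₀ : EuclideanSpace ℝ (Fin 3)} {u : ℝ → EuclideanSpace ℝ (Fin 3) → EuclideanSpace ℝ (Fin 3)}
      {p : ℝ → EuclideanSpace ℝ (Fin 3) → ℝ},
      0 < ν → 0 < R → IsL3inftyLocalPair ν R (t₀, x₀) u p →
      ENNReal.ofReal ((ν ^ 2 * R ^ 2)⁻¹) *
          ∫⁻ z in viscousCylinder ν R (t₀, x₀),
            (‖u z.1 z.2‖ₑ ^ 3 + ‖p z.1 z.2‖ₑ ^ (3 / 2 : ℝ)) < ENNReal.ofReal ε₀ →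
      ∀ᵐ z ∂(volume.restrict (viscousCylinder ν (R / 2) (t₀, x₀))), ‖u z.1 z.2‖ ≤ c₀ * ν / R)
    (hP : ess_associated_pressure) : ess_sup_bound := by
  intro ν T hν hT u₀ u hu₀ hdiv hu h₃ δ hδ
  -- the associated pressure (3.2)–(3.4) and the distributional system on the strip
  obtain ⟨p, hp, hdist⟩ := hP hν hT hu₀ hdiv hu h₃
  -- the jointly measurable square-integrable weak spatial gradient on the strip
  obtain ⟨G, hG, -, hGint, -⟩ := hu.exists_hasWeakSpatialGradientOn
  -- sliced bounds: energy class, `L_{3,∞}`, `L_{3/2,∞}`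
  obtain ⟨C₂, hC₂⟩ := hu.energy_bound
  have hC₂' : ∀ᵐ t ∂(volume.restrict (Ioo 0 T)), ∫⁻ x, ‖u t x‖ₑ ^ 2 ≤ C₂ :=
    hC₂.mono fun t ht => by simpa only [FluidPDE.eEnergy] using ht
  obtain ⟨C₃, hC₃⟩ := ae_lintegral_enorm_pow_three_le h₃
  obtain ⟨Cp, hCp⟩ := ae_lintegral_enorm_rpow_threeHalves_le hp
  -- the smallness density of Lemma 2.2 is integrable over the strip
  set F : ℝ × EuclideanSpace ℝ (Fin 3) → ℝ≥0∞ := fun z => ‖u z.1 z.2‖ₑ ^ 3 + ‖p z.1 z.2‖ₑ ^ (3 / 2 : ℝ) with hFdef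
  have hF : ∫⁻ z in Ioo 0 T ×ˢ (univ : Set (EuclideanSpace ℝ (Fin 3))), F z < ∞ := by
    have hslice : ∀ᵐ t ∂(volume.restrict (Ioo 0 T)), ∫⁻ x, F (t, x) ≤ (C₃ : ℝ≥0∞) + Cp := by
      filter_upwards [hC₃, hCp, h₃.1] with t h3 hp' hm
      have hfm : AEMeasurable (fun x => ‖u t x‖ₑ ^ 3) volume := hm.1.enorm.pow_const 3
      calc ∫⁻ x, F (t, x) = ∫⁻ x, ‖u t x‖ₑ ^ 3 + ‖p t x‖ₑ ^ (3 / 2 : ℝ) := rfl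
        _ = (∫⁻ x, ‖u t x‖ₑ ^ 3) + ∫⁻ x, ‖p t x‖ₑ ^ (3 / 2 : ℝ) := lintegral_add_left' hfm _
        _ ≤ C₃ + Cp := add_le_add h3 hp'
    refine (lintegral_strip_le_of_ae_slice_le hslice).trans_lt ?_
    refine ENNReal.mul_lt_top (ENNReal.add_lt_top.2 ⟨ENNReal.coe_lt_top, ENNReal.coe_lt_top⟩) ?_
    rw [Real.volume_Ioo]
    exact ENNReal.ofReal_lt_top
  -- the radius: `R² / ν = δ / 2`
  set R : ℝ := Real.sqrt (ν * δ / 2) with hRdef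
  have hνδ : 0 < ν * δ / 2 := by have := hδ.1; positivity
  have hR : 0 < R := Real.sqrt_pos.2 hνδ
  have hR2 : R ^ 2 / ν = δ / 2 := by
    rw [hRdef, Real.sq_sqrt hνδ.le]
    field_simp
  -- Step 1: the hypotheses of Thm. 1.4 on every cylinder `Q_ν(z₀, R)`, `t₀ ∈ [δ, T]`
  have hloc : ∀ t₀ ∈ Icc δ T, ∀ x₀ : EuclideanSpace ℝ (Fin 3), IsL3inftyLocalPair ν R (t₀, x₀) u p :=
    fun t₀ ht₀ x₀ => isL3inftyLocalPair_of_strip (by rw [hR2]; linarith [ht₀.1, hδ.1]) ht₀.2 hdist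
      hC₂' hC₃ hG hGint hF
  -- Step 2 (near field): the hypothesis `hnear` on every half cylinder
  have near : ∀ t₀ ∈ Icc δ T, ∀ x₀ : EuclideanSpace ℝ (Fin 3), ∃ M : ℝ,
      ∀ᵐ z ∂(volume.restrict (viscousCylinder ν (R / 2) (t₀, x₀))), ‖u z.1 z.2‖ ≤ M :=
    fun t₀ ht₀ x₀ => hnear hν hR (hloc t₀ ht₀ x₀)
  -- Step 3 (far field): Lemma 2.2 rescaled, with the smallness supplied by the tails of `F`
  obtain ⟨ε₀, c₀, hε₀, hc₀, Hfar⟩ := hsc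
  have hη : 0 < ENNReal.ofReal (ν ^ 2 * R ^ 2 * ε₀) := ENNReal.ofReal_pos.2 (by positivity)
  obtain ⟨n, hn⟩ := exists_radius_tail_lt hF hη
  have far : ∀ t₀ ∈ Icc δ T, ∀ x₀ : EuclideanSpace ℝ (Fin 3), (n : ℝ) + R < ‖x₀‖ →
      ∀ᵐ z ∂(volume.restrict (viscousCylinder ν (R / 2) (t₀, x₀))), ‖u z.1 z.2‖ ≤ c₀ * ν / R := by
    intro t₀ ht₀ x₀ hx₀
    refine Hfar hν hR (hloc t₀ ht₀ x₀) ?_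
    have hsub : viscousCylinder ν R (t₀, x₀) ⊆
        (Ioo 0 T ×ˢ (univ : Set (EuclideanSpace ℝ (Fin 3)))) ∩ {z | (n : ℝ) ≤ ‖z.2‖} := by
      intro z hz
      simp only [mem_viscousCylinder] at hz
      obtain ⟨⟨hz1, hz2⟩, hz3⟩ := hz
      refine ⟨⟨⟨?_, hz2.trans_le ht₀.2⟩, mem_univ _⟩, ?_⟩
      · rw [hR2] at hz1
        linarith [ht₀.1, hδ.1]
      · show (n : ℝ) ≤ ‖z.2‖
        have h1 := norm_sub_norm_le x₀ z.2
        rw [← dist_eq_norm, dist_comm] at h1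
        linarith
    have h1 : ∫⁻ z in viscousCylinder ν R (t₀, x₀), F z < ENNReal.ofReal (ν ^ 2 * R ^ 2 * ε₀) :=
      (lintegral_mono_set hsub).trans_lt hn
    have ha : ENNReal.ofReal ((ν ^ 2 * R ^ 2)⁻¹) ≠ 0 := (ENNReal.ofReal_pos.2 (by positivity)).ne'
    have h2 := ENNReal.mul_lt_mul_right ha ENNReal.ofReal_ne_top h1
    refine lt_of_lt_of_eq h2 ?_
    rw [← ENNReal.ofReal_mul (by positivity)]
    congr 1
    field_simp
  -- Step 2 concluded: finitely many cylinders over the compact `[δ, T] × B̄(0, n + R)`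
  set K : Set (ℝ × EuclideanSpace ℝ (Fin 3)) := Icc δ T ×ˢ closedBall (0 : EuclideanSpace ℝ (Fin 3)) ((n : ℝ) + R) with hKdef
  have hK : IsCompact K := isCompact_Icc.prod (isCompact_closedBall _ _)
  have hnear' : ∃ M : ℝ, ∀ᵐ w ∂(volume : Measure (ℝ × EuclideanSpace ℝ (Fin 3))), w ∈ K → w.1 < T → ‖u w.1 w.2‖ ≤ M := by
    refine hK.induction_on
      (p := fun A => ∃ M : ℝ, ∀ᵐ w ∂(volume : Measure (ℝ × EuclideanSpace ℝ (Fin 3))), w ∈ A → w.1 < T → ‖u w.1 w.2‖ ≤ M)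
      ?_ ?_ ?_ ?_
    · exact ⟨0, Eventually.of_forall fun w hw => hw.elim⟩
    · rintro A B hAB ⟨M, hM⟩
      exact ⟨M, hM.mono fun w hw hwA => hw (hAB hwA)⟩
    · rintro A B ⟨M, hM⟩ ⟨M', hM'⟩
      refine ⟨max M M', ?_⟩
      filter_upwards [hM, hM'] with w hw hw'
      rintro (hA | hB) hwT
      · exact (hw hA hwT).trans (le_max_left _ _)
      · exact (hw' hB hwT).trans (le_max_right _ _)
    · rintro z ⟨hz1, -⟩
      obtain ⟨t₀, ht₀, U, hUo, hzU, hU⟩ :=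
        exists_nhds_subset_viscousCylinder (δ := δ) (T := T) hν hR hz1
      obtain ⟨M, hM⟩ := near t₀ ht₀ z.2
      refine ⟨U, mem_nhdsWithin_of_mem_nhds (hUo.mem_nhds hzU), M, ?_⟩
      rw [ae_restrict_iff' (measurableSet_viscousCylinder _ _ _)] at hM
      filter_upwards [hM] with w hw hwU hwT
      exact hw (hU w hwU hwT)
  obtain ⟨M₁, hM₁⟩ := hnear'
  -- Step 3 concluded: countably many cylinders over the far region (Lindelöf)
  set FR : Set (ℝ × EuclideanSpace ℝ (Fin 3)) := {z | z.1 ∈ Icc δ T ∧ (n : ℝ) + R < ‖z.2‖} with hFRdef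
  have hfar : ∀ᵐ w ∂(volume : Measure (ℝ × EuclideanSpace ℝ (Fin 3))), w ∈ FR → w.1 < T → ‖u w.1 w.2‖ ≤ c₀ * ν / R := by
    choose! t₀ ht₀ U hUo hzU hU using
      fun (z : ℝ × EuclideanSpace ℝ (Fin 3)) (hz : z ∈ FR) =>
      exists_nhds_subset_viscousCylinder (ν := ν) (R := R) (δ := δ) (T := T) hν hR hz.1
    obtain ⟨t, htFR, htc, hcover⟩ := TopologicalSpace.countable_cover_nhdsWithin (f := U)
      (s := FR) fun z hz => mem_nhdsWithin_of_mem_nhds ((hUo z hz).mem_nhds (hzU z hz))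
    have hall : ∀ᵐ w ∂(volume : Measure (ℝ × EuclideanSpace ℝ (Fin 3))), ∀ z ∈ t,
        w ∈ U z → w.1 < T → ‖u w.1 w.2‖ ≤ c₀ * ν / R := by
      refine (eventually_countable_ball htc).2 fun z hz => ?_
      have hzFR : z ∈ FR := htFR hz
      have h1 := far (t₀ z) (ht₀ z hzFR) z.2 hzFR.2
      rw [ae_restrict_iff' (measurableSet_viscousCylinder _ _ _)] at h1
      filter_upwards [h1] with w hw hwU hwT
      exact hw (hU z hzFR w hwU hwT)
    filter_upwards [hall] with w hw hwFR hwT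
    obtain ⟨z, hz, hwz⟩ := mem_iUnion₂.1 (hcover hwFR)
    exact hw z hz hwz hwT
  -- Step 4: the bound a.e. on `]δ, T[ × ℝ³`, hence `u ∈ L^∞(δ, T; L^∞)`
  have hB : ∀ᵐ w ∂(volume : Measure (ℝ × EuclideanSpace ℝ (Fin 3))), w.1 ∈ Ioo δ T → ‖u w.1 w.2‖ ≤ max M₁ (c₀ * ν / R) := by
    filter_upwards [hM₁, hfar] with w hw1 hw2 hwI
    by_cases hx : ‖w.2‖ ≤ (n : ℝ) + R
    · exact (hw1 ⟨Ioo_subset_Icc_self hwI, mem_closedBall_zero_iff.2 hx⟩ hwI.2).trans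
        (le_max_left _ _)
    · exact (hw2 ⟨Ioo_subset_Icc_self hwI, not_le.1 hx⟩ hwI.2).trans (le_max_right _ _)
  have hmeas : ∀ᵐ t ∂(volume.restrict (Ioo δ T)), AEStronglyMeasurable (u t) volume :=
    (ae_restrict_of_ae_restrict_of_subset (Ioo_subset_Ioo hδ.1.le le_rfl) h₃.1).mono fun t ht => ht.1
  exact memLqLp_top_top_of_ae_bound hmeas hB

/-! ### The unit picture: point-wise smallness on `Q̄(1/2)` gives an a.e. bound on `Q(1/2)` -/

/-- **Bounded pieces patch to an a.e. bound on `Q(1/2)`** (the covering step of ESS 2003, §3,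
"Lemma 2.2 by scaling" at every point of `Q̄(1/2)`, in its boundedness form). Let `(v, p)` satisfy
the hypotheses (1.15)–(1.16) of Thm. 1.4 on `Q(1)`, let `ε₀, c₀` be constants for which the
rescaled ε-regularity *bound* holds (hypothesis `Hsc`, the body of `ess_epsilon_bound_scaled_LR`:
smallness `(νR)⁻² ∫_{Q_ν(z₀,R)} (|u|³ + |p|^{3/2}) < ε₀` for a pair with (1.15)–(1.16) on
`Q_ν(z₀, R)` gives `|u| ≤ c₀ ν / R` a.e. on `Q_ν(z₀, R/2)`), and suppose that at **every**
`z ∈ Q̄(1/2)` there is a scale `0 < r ≤ 1/2` with `r⁻² ∫_{Q(z,r)} (|v|³ + |p|^{3/2}) < ε₀`. Then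
`v` is essentially bounded on `Q(1/2)`. Proof: at a good apex `(t₁, x₁)` the hypotheses restrict
to `Q((t₁,x₁), r) ⊆ Q(1)` (`IsL3inftyLocalPair.restrict`) and `Hsc` (`ν = 1`) bounds `|v|` by
`c₀ / r` a.e. on `Q((t₁,x₁), r/2)`; a point `z = (t, x)` of `Q̄(1/2)` with `t < 0` lies inside the
half cylinder hanging from `(t + δ, x)`, still a good apex for small `δ > 0`
(`exists_shift_apex_small`), and a point with `t = 0` is the apex of a half cylinder containing
every point of `Q(1/2)` near it; finitely many such neighbourhoods cover the compact `Q̄(1/2)`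
(`IsCompact.induction_on`). [cite: EscauriazaSereginSverak2003, §3 (3.5)–(3.6)] -/
theorem exists_ae_bound_half_of_forall_small {ε₀ c₀ : ℝ}
    (Hsc : ∀ {ν R t₀ : ℝ} {x₀ : EuclideanSpace ℝ (Fin 3)} {u : ℝ → EuclideanSpace ℝ (Fin 3) → EuclideanSpace ℝ (Fin 3)} {p : ℝ → EuclideanSpace ℝ (Fin 3) → ℝ},
      0 < ν → 0 < R → IsL3inftyLocalPair ν R (t₀, x₀) u p →
      ENNReal.ofReal ((ν ^ 2 * R ^ 2)⁻¹) *
          ∫⁻ z in viscousCylinder ν R (t₀, x₀),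
            (‖u z.1 z.2‖ₑ ^ 3 + ‖p z.1 z.2‖ₑ ^ (3 / 2 : ℝ)) < ENNReal.ofReal ε₀ →
      ∀ᵐ z ∂(volume.restrict (viscousCylinder ν (R / 2) (t₀, x₀))), ‖u z.1 z.2‖ ≤ c₀ * ν / R)
    {v : ℝ → EuclideanSpace ℝ (Fin 3) → EuclideanSpace ℝ (Fin 3)} {p : ℝ → EuclideanSpace ℝ (Fin 3) → ℝ} (h : IsL3inftyLocalPair 1 1 ((0 : ℝ), (0 : EuclideanSpace ℝ (Fin 3))) v p)
    (hgood : ∀ z ∈ closure (parabolicCylinder (1 / 2) ((0 : ℝ), (0 : EuclideanSpace ℝ (Fin 3)))),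
      ∃ r ∈ Ioc (0 : ℝ) (1 / 2), ENNReal.ofReal ((r ^ 2)⁻¹) *
        ∫⁻ w in parabolicCylinder r z, (‖v w.1 w.2‖ₑ ^ 3 + ‖p w.1 w.2‖ₑ ^ (3 / 2 : ℝ)) <
          ENNReal.ofReal ε₀) :
    ∃ M : ℝ, ∀ᵐ w ∂(volume.restrict (parabolicCylinder (1 / 2) ((0 : ℝ), (0 : EuclideanSpace ℝ (Fin 3))))),
      ‖v w.1 w.2‖ ≤ M := by
  set F : ℝ × EuclideanSpace ℝ (Fin 3) → ℝ≥0∞ := fun w => ‖v w.1 w.2‖ₑ ^ 3 + ‖p w.1 w.2‖ₑ ^ (3 / 2 : ℝ) with hF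
  -- ## `∫_{Q(1)} (|v|³ + |p|^{3/2}) < ∞`
  obtain ⟨h1, -, -, h4, ⟨C₃, h5⟩⟩ := IsL3inftyLocalPair.unit_iff.1 h
  have hFfin : ∫⁻ w in parabolicCylinder 1 ((0 : ℝ), (0 : EuclideanSpace ℝ (Fin 3))), F w ≠ ∞ := by
    have hmeas : AEMeasurable (fun w : ℝ × EuclideanSpace ℝ (Fin 3) => ‖v w.1 w.2‖ₑ ^ 3)
        (volume.restrict (parabolicCylinder 1 ((0 : ℝ), (0 : EuclideanSpace ℝ (Fin 3))))) :=
      (h1.1.aestronglyMeasurable.enorm.pow_const 3)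
    rw [hF, lintegral_add_left' hmeas]
    refine (ENNReal.add_lt_top.2 ⟨?_, h4⟩).ne
    rw [parabolicCylinder_one_zero]
    calc ∫⁻ w in Ioo (-1 : ℝ) 0 ×ˢ ball (0 : EuclideanSpace ℝ (Fin 3)) 1, ‖v w.1 w.2‖ₑ ^ 3
        = ∫⁻ w in Ioo (-1 : ℝ) 0 ×ˢ ball (0 : EuclideanSpace ℝ (Fin 3)) 1, ‖uncurry v w‖ₑ ^ 3 := rfl
      _ ≤ C₃ * volume (Ioo (-1 : ℝ) 0) := setLIntegral_prod_le_of_slice_bound h5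
      _ < ∞ := ENNReal.mul_lt_top ENNReal.coe_lt_top
          (by rw [Real.volume_Ioo]; exact ENNReal.ofReal_lt_top)
  -- ## the bounded piece below a good apex `(t₁, x₁)` at scale `r`
  have hpiece : ∀ {r t₁ : ℝ} {x₁ : EuclideanSpace ℝ (Fin 3)}, 0 < r → r ≤ 1 / 2 → t₁ ≤ 0 → -(1 / 4) ≤ t₁ →
      ‖x₁‖ ≤ 1 / 2 →
      ENNReal.ofReal ((r ^ 2)⁻¹) * ∫⁻ w in parabolicCylinder r (t₁, x₁), F w < ENNReal.ofReal ε₀ →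
      ∀ᵐ w ∂(volume.restrict (parabolicCylinder (r / 2) (t₁, x₁))), ‖v w.1 w.2‖ ≤ c₀ / r := by
    intro r t₁ x₁ hr0 hr ht₁ ht₁' hx₁ hsmall
    have hr2 : r ^ 2 ≤ 1 / 4 := by nlinarith
    have hI : Ioo ((t₁, x₁).1 - r ^ 2) (t₁, x₁).1 ⊆ Ioo (-1 : ℝ) 0 :=
      Ioo_subset_Ioo (by dsimp only; linarith) ht₁
    have hB : ball (t₁, x₁).2 r ⊆ ball (0 : EuclideanSpace ℝ (Fin 3)) 1 := ball_subset_unitBall_of_half hx₁ hr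
    have hloc : IsL3inftyLocalPair 1 r (t₁, x₁) v p := h.restrict hI hB
    have hsmall' : ENNReal.ofReal (((1 : ℝ) ^ 2 * r ^ 2)⁻¹) *
        ∫⁻ w in viscousCylinder 1 r (t₁, x₁), F w < ENNReal.ofReal ε₀ := by
      rwa [one_pow, one_mul, viscousCylinder_one]
    have key := Hsc one_pos hr0 hloc hsmall'
    rw [viscousCylinder_one, mul_one] at key
    exact key
  -- ## compactness of `Q̄(1/2)`
  set S : Set (ℝ × EuclideanSpace ℝ (Fin 3)) := parabolicCylinder (1 / 2) ((0 : ℝ), (0 : EuclideanSpace ℝ (Fin 3))) with hS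
  have hSm : MeasurableSet S := (isOpen_parabolicCylinder _ _).measurableSet
  have hXc : IsCompact (closure S) := by
    rw [hS, closure_parabolicCylinder_half_origin]
    exact isCompact_Icc.prod (isCompact_closedBall _ _)
  have hmain : ∃ M : ℝ, ∀ᵐ w ∂(volume : Measure (ℝ × EuclideanSpace ℝ (Fin 3))),
      w ∈ closure S → w ∈ S → ‖v w.1 w.2‖ ≤ M := by
    refine hXc.induction_on (p := fun A => ∃ M : ℝ, ∀ᵐ w ∂(volume : Measure (ℝ × EuclideanSpace ℝ (Fin 3))),
        w ∈ A → w ∈ S → ‖v w.1 w.2‖ ≤ M) ?_ ?_ ?_ ?_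
    · exact ⟨0, Eventually.of_forall fun w hw => hw.elim⟩
    · rintro A B hAB ⟨M, hM⟩
      exact ⟨M, hM.mono fun w hw hwA => hw (hAB hwA)⟩
    · rintro A B ⟨M, hM⟩ ⟨M', hM'⟩
      refine ⟨max M M', ?_⟩
      filter_upwards [hM, hM'] with w hw hw'
      rintro (hA | hB) hwS
      · exact (hw hA hwS).trans (le_max_left _ _)
      · exact (hw' hB hwS).trans (le_max_right _ _)
    · intro z hz
      have hz' : z ∈ Icc (-(1 / 4) : ℝ) 0 ×ˢ closedBall (0 : EuclideanSpace ℝ (Fin 3)) (1 / 2) := by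
        rwa [hS, closure_parabolicCylinder_half_origin] at hz
      have hzt : -(1 / 4) ≤ z.1 ∧ z.1 ≤ 0 := hz'.1
      have hzx : ‖z.2‖ ≤ 1 / 2 := by simpa [mem_closedBall, dist_zero_right] using hz'.2
      obtain ⟨r, ⟨hr0, hr⟩, hsmall⟩ := hgood z hz
      have hr4 : (r / 2) ^ 2 = r ^ 2 / 4 := by ring
      rcases eq_or_lt_of_le hzt.2 with ht0 | ht0
      · -- ### apex on the top slice: the piece hangs from `z` itself
        have hO := hpiece hr0 hr hzt.2 hzt.1 hzx (t₁ := z.1) (x₁ := z.2) hsmall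
        set U : Set (ℝ × EuclideanSpace ℝ (Fin 3)) := Ioi (z.1 - (r / 2) ^ 2) ×ˢ ball z.2 (r / 2) with hU
        have hUo : IsOpen U := isOpen_Ioi.prod isOpen_ball
        have hzU : z ∈ U := ⟨by show z.1 - (r / 2) ^ 2 < z.1; nlinarith, mem_ball_self (half_pos hr0)⟩
        refine ⟨U, mem_nhdsWithin_of_mem_nhds (hUo.mem_nhds hzU), c₀ / r, ?_⟩
        rw [ae_restrict_iff' ((isOpen_parabolicCylinder _ _).measurableSet)] at hO
        filter_upwards [hO] with w hw hwU hwS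
        refine hw ?_
        have hwS' : w ∈ S := hwS
        rw [hS, mem_parabolicCylinder] at hwS'
        obtain ⟨hw1, hw2⟩ := hwU
        rw [mem_ball] at hw2
        simp only [mem_parabolicCylinder]
        exact ⟨⟨hw1, by rw [ht0]; exact hwS'.1.2⟩, hw2⟩
      · -- ### interior apex: shift the apex up by a small `δ`
        set δ₀ : ℝ := min (-z.1) (r ^ 2 / 8) with hδ₀
        have hδ₀pos : 0 < δ₀ := lt_min (by linarith) (by positivity)
        have hδ₀t : δ₀ ≤ -z.1 := min_le_left _ _
        have hδ₀r : δ₀ ≤ r ^ 2 / 8 := min_le_right _ _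
        set F' : ℝ × EuclideanSpace ℝ (Fin 3) → ℝ≥0∞ := fun w => ENNReal.ofReal ((r ^ 2)⁻¹) * F w with hF'
        have hF'int : ∀ A : Set (ℝ × EuclideanSpace ℝ (Fin 3)), ∫⁻ w in A, F' w =
            ENNReal.ofReal ((r ^ 2)⁻¹) * ∫⁻ w in A, F w :=
          fun A => lintegral_const_mul' _ _ ENNReal.ofReal_ne_top
        have hlayer : Ico z.1 (z.1 + δ₀) ×ˢ ball z.2 r ⊆ parabolicCylinder 1 ((0 : ℝ), (0 : EuclideanSpace ℝ (Fin 3))) := by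
          rw [parabolicCylinder_one_zero]
          exact prod_mono (fun s hs => ⟨by linarith [hs.1], by linarith [hs.2]⟩)
            (ball_subset_unitBall_of_half hzx hr)
        have hfin' : ∫⁻ w in Ico z.1 (z.1 + δ₀) ×ˢ ball z.2 r, F' w ≠ ∞ := by
          rw [hF'int]
          exact ENNReal.mul_ne_top ENNReal.ofReal_ne_top
            (ne_top_of_le_ne_top hFfin (lintegral_mono_set hlayer))
        have hsmall' : ∫⁻ w in parabolicCylinder r (z.1, z.2), F' w < ENNReal.ofReal ε₀ := by
          rw [hF'int]; exact hsmall
        obtain ⟨δ, hδ, hδle, hδsmall⟩ := exists_shift_apex_small F' hδ₀pos hfin' hsmall'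
        rw [hF'int] at hδsmall
        have ht₁ : z.1 + δ ≤ 0 := by linarith
        have ht₁' : -(1 / 4) ≤ z.1 + δ := by linarith
        have hO := hpiece hr0 hr ht₁ ht₁' hzx (x₁ := z.2) hδsmall
        set U : Set (ℝ × EuclideanSpace ℝ (Fin 3)) := Ioo (z.1 - r ^ 2 / 16) (z.1 + δ) ×ˢ ball z.2 (r / 2) with hU
        have hUo : IsOpen U := isOpen_Ioo.prod isOpen_ball
        have hzU : z ∈ U := ⟨⟨by nlinarith, by linarith⟩, mem_ball_self (half_pos hr0)⟩
        refine ⟨U, mem_nhdsWithin_of_mem_nhds (hUo.mem_nhds hzU), c₀ / r, ?_⟩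
        rw [ae_restrict_iff' ((isOpen_parabolicCylinder _ _).measurableSet)] at hO
        filter_upwards [hO] with w hw hwU _
        refine hw ?_
        obtain ⟨⟨hw1, hw2⟩, hw3⟩ := hwU
        rw [mem_ball] at hw3
        simp only [mem_parabolicCylinder]
        have hr2pos : 0 < r ^ 2 := by positivity
        exact ⟨⟨by rw [hr4]; linarith, hw2⟩, hw3⟩
  obtain ⟨M, hM⟩ := hmain
  refine ⟨M, ?_⟩
  rw [ae_restrict_iff' hSm]
  filter_upwards [hM] with w hw hwS
  exact hw (subset_closure hwS) hwS

/-! ### Transport to viscous cylinders -/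

section Rescale

variable {ν R t₀ : ℝ} {x₀ : EuclideanSpace ℝ (Fin 3)} {u : ℝ → EuclideanSpace ℝ (Fin 3) → EuclideanSpace ℝ (Fin 3)} {p : ℝ → EuclideanSpace ℝ (Fin 3) → ℝ}

/-- **Essential boundedness on `Q_ν(z₀, R/2)` without Theorem 1.4** (ESS 2003, §3, proof of
(3.5): "making the obvious scaling `ṽ(y, s) = R v(x₀ + Ry, t₀ + R²s)`, `p̃ = R² p(…)`, the pair
`ṽ, p̃` satisfies all conditions of Theorem 1.4"). If `(u, p)` satisfies (1.15)–(1.16) on the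
viscous cylinder `Q_ν(z₀, R)` (viscosity `ν > 0`), if no pair with (1.15)–(1.16) on `Q(1)` has
a point of `ε`-concentration in `Q̄(1/2)` (hypothesis `hno`, verbatim that of
`ess_local_holder_of_epsilonRegularity_of_noConcentration`), and if the rescaled ε-regularity
bound holds with constants `ε₀ > 0`, `c₀` (hypothesis `Hsc`), then `u` is essentially bounded on
`Q_ν(z₀, R/2)`: the rescaled pair satisfies (1.15)–(1.16) on `Q(1)`
(`IsL3inftyLocalPair.stRescale`), is essentially bounded on `Q(1/2)` by
`exists_ae_bound_half_of_forall_small`, and the a.e. bound is transported back along the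
measure-scaling affine map (as in the accepted `IsL3inftyLocalPair.exists_ae_bound`). Real proof.
[cite: EscauriazaSereginSverak2003, §3 (3.5)] -/
theorem IsL3inftyLocalPair.exists_ae_bound_of_noConcentration {ε₀ c₀ : ℝ}
    (Hsc : ∀ {ν R t₀ : ℝ} {x₀ : EuclideanSpace ℝ (Fin 3)} {u : ℝ → EuclideanSpace ℝ (Fin 3) → EuclideanSpace ℝ (Fin 3)} {p : ℝ → EuclideanSpace ℝ (Fin 3) → ℝ},
      0 < ν → 0 < R → IsL3inftyLocalPair ν R (t₀, x₀) u p →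
      ENNReal.ofReal ((ν ^ 2 * R ^ 2)⁻¹) *
          ∫⁻ z in viscousCylinder ν R (t₀, x₀),
            (‖u z.1 z.2‖ₑ ^ 3 + ‖p z.1 z.2‖ₑ ^ (3 / 2 : ℝ)) < ENNReal.ofReal ε₀ →
      ∀ᵐ z ∂(volume.restrict (viscousCylinder ν (R / 2) (t₀, x₀))), ‖u z.1 z.2‖ ≤ c₀ * ν / R)
    (hε₀ : 0 < ε₀)
    (hno : ∀ (v : ℝ → EuclideanSpace ℝ (Fin 3) → EuclideanSpace ℝ (Fin 3)) (p : ℝ → EuclideanSpace ℝ (Fin 3) → ℝ), IsL3inftyLocalPair 1 1 ((0 : ℝ), (0 : EuclideanSpace ℝ (Fin 3))) v p →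
      ∀ z ∈ closure (parabolicCylinder (1 / 2) ((0 : ℝ), (0 : EuclideanSpace ℝ (Fin 3)))), ∀ ε : ℝ, 0 < ε →
        ∃ r ∈ Ioc (0 : ℝ) (1 / 2), ENNReal.ofReal ((r ^ 2)⁻¹) *
          ∫⁻ w in parabolicCylinder r z, (‖v w.1 w.2‖ₑ ^ 3 + ‖p w.1 w.2‖ₑ ^ (3 / 2 : ℝ)) <
            ENNReal.ofReal ε)
    (h : IsL3inftyLocalPair ν R (t₀, x₀) u p) (hν : 0 < ν) (hR : 0 < R) :
    ∃ M : ℝ, ∀ᵐ z ∂(volume.restrict (viscousCylinder ν (R / 2) (t₀, x₀))), ‖u z.1 z.2‖ ≤ M := by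
  have hα : 0 < R / ν := by positivity
  have hβ : 0 < R ^ 2 / ν := by positivity
  have h' := h.stRescale hν hR
  obtain ⟨M, hM⟩ := exists_ae_bound_half_of_forall_small Hsc h'
    (fun z hz => hno _ _ h' z hz ε₀ hε₀)
  set Q₂ := parabolicCylinder (1 / 2) ((0 : ℝ), (0 : EuclideanSpace ℝ (Fin 3))) with hQ₂
  have hae' : ∀ᵐ z ∂(volume.restrict Q₂),
      ‖(R / ν) • u (stAffine (R ^ 2 / ν) R t₀ x₀ z).1 (stAffine (R ^ 2 / ν) R t₀ x₀ z).2‖ ≤ M := by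
    filter_upwards [hM] with z hz
    have e : ((R / ν) • stPull (R ^ 2 / ν) R t₀ x₀ u) z.1 z.2 =
        (R / ν) • u (stAffine (R ^ 2 / ν) R t₀ x₀ z).1 (stAffine (R ^ 2 / ν) R t₀ x₀ z).2 := rfl
    rw [← e]
    exact hz
  rw [hQ₂, ← stAffine_preimage_viscousCylinder_half hν hR t₀ x₀] at hae'
  have h6 := ae_restrict_of_ae_restrict_preimage_stAffine hβ hR t₀ x₀
    (P := fun z => ‖(R / ν) • u z.1 z.2‖ ≤ M) hae'
  refine ⟨M / (R / ν), ?_⟩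
  filter_upwards [h6] with z hz
  rw [norm_smul, Real.norm_eq_abs, abs_of_pos hα] at hz
  rw [le_div_iff₀ hα, mul_comm]
  exact hz

end Rescale

/-! ### `ess_sup_bound`, ESS (1.14) and ns.S08 from the absence of points of concentration -/

/-- **ESS (3.6) from the absence of points of concentration, the rescaled ε-regularity bound and
the associated pressure** (Escauriaza–Seregin–Šverák 2003, §3, (3.5)–(3.6)): the near-field
bound of `ess_sup_bound_of_nearBound_scaled` is supplied by
`IsL3inftyLocalPair.exists_ae_bound_of_noConcentration`. Real proof.
[cite: EscauriazaSereginSverak2003, §3 (3.5)–(3.6)] -/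
theorem ess_sup_bound_of_noConcentration_scaled
    (hno : ∀ (v : ℝ → EuclideanSpace ℝ (Fin 3) → EuclideanSpace ℝ (Fin 3)) (p : ℝ → EuclideanSpace ℝ (Fin 3) → ℝ), IsL3inftyLocalPair 1 1 ((0 : ℝ), (0 : EuclideanSpace ℝ (Fin 3))) v p →
      ∀ z ∈ closure (parabolicCylinder (1 / 2) ((0 : ℝ), (0 : EuclideanSpace ℝ (Fin 3)))), ∀ ε : ℝ, 0 < ε →
        ∃ r ∈ Ioc (0 : ℝ) (1 / 2), ENNReal.ofReal ((r ^ 2)⁻¹) *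
          ∫⁻ w in parabolicCylinder r z, (‖v w.1 w.2‖ₑ ^ 3 + ‖p w.1 w.2‖ₑ ^ (3 / 2 : ℝ)) <
            ENNReal.ofReal ε)
    (hsc : ∃ ε₀ c₀ : ℝ, 0 < ε₀ ∧ 0 < c₀ ∧ ∀ {ν R t₀ : ℝ} {x₀ : EuclideanSpace ℝ (Fin 3)} {u : ℝ → EuclideanSpace ℝ (Fin 3) → EuclideanSpace ℝ (Fin 3)}
      {p : ℝ → EuclideanSpace ℝ (Fin 3) → ℝ},
      0 < ν → 0 < R → IsL3inftyLocalPair ν R (t₀, x₀) u p →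
      ENNReal.ofReal ((ν ^ 2 * R ^ 2)⁻¹) *
          ∫⁻ z in viscousCylinder ν R (t₀, x₀),
            (‖u z.1 z.2‖ₑ ^ 3 + ‖p z.1 z.2‖ₑ ^ (3 / 2 : ℝ)) < ENNReal.ofReal ε₀ →
      ∀ᵐ z ∂(volume.restrict (viscousCylinder ν (R / 2) (t₀, x₀))), ‖u z.1 z.2‖ ≤ c₀ * ν / R)
    (hP : ess_associated_pressure) : ess_sup_bound := by
  obtain ⟨ε₀, c₀, hε₀, hc₀, H⟩ := hsc
  exact ess_sup_bound_of_nearBound_scaled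
    (fun hν hR h => h.exists_ae_bound_of_noConcentration H hε₀ hno hν hR) ⟨ε₀, c₀, hε₀, hc₀, H⟩ hP

/-- **ESS (3.5)–(3.6) from the absence of points of concentration alone.** The named fact
`ess_sup_bound` (boundedness away from `t = 0` of `L_{3,∞}` Leray–Hopf solutions of the Cauchy
problem) follows from the statement that no pair with (1.15)–(1.16) on `Q(1)` has a point of
`ε`-concentration of `|v|³ + |p|^{3/2}` in `Q̄(1/2)` — the blow-up / backward-uniqueness content of
ESS §3, (3.8)–(3.35), hypothesis `hno` verbatim that of
`ess_local_holder_of_epsilonRegularity_of_noConcentration` — the ε-regularity bound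
(Lemarié-Rieusset 2016, Thm. 14.4: `lemarieRieusset_epsilon_regularity_holds`, through the
accepted `ess_epsilon_bound_scaled_LR`) and the associated pressure
(`ess_associated_pressure_holds`) being theorems. In particular the Hölder form of Lemma 2.2
(`ess_epsilon_regularity'`) is not needed for (3.6). Real proof.
[cite: EscauriazaSereginSverak2003, §3 (3.5)–(3.6)] -/
theorem ess_sup_bound_of_noConcentration
    (hno : ∀ (v : ℝ → EuclideanSpace ℝ (Fin 3) → EuclideanSpace ℝ (Fin 3)) (p : ℝ → EuclideanSpace ℝ (Fin 3) → ℝ), IsL3inftyLocalPair 1 1 ((0 : ℝ), (0 : EuclideanSpace ℝ (Fin 3))) v p →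
      ∀ z ∈ closure (parabolicCylinder (1 / 2) ((0 : ℝ), (0 : EuclideanSpace ℝ (Fin 3)))), ∀ ε : ℝ, 0 < ε →
        ∃ r ∈ Ioc (0 : ℝ) (1 / 2), ENNReal.ofReal ((r ^ 2)⁻¹) *
          ∫⁻ w in parabolicCylinder r z, (‖v w.1 w.2‖ₑ ^ 3 + ‖p w.1 w.2‖ₑ ^ (3 / 2 : ℝ)) <
            ENNReal.ofReal ε) :
    ess_sup_bound :=
  ess_sup_bound_of_noConcentration_scaled hno
    (ess_epsilon_bound_scaled_LR lemarieRieusset_epsilon_regularity_holds)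
    ess_associated_pressure_holds

/-- **ESS (1.14) from the absence of points of concentration alone**: the `L₅(Q_T)`
integrability `ess_L5_integrability` follows from `hno` (as in `ess_sup_bound_of_noConcentration`)
through the accepted `ess_L5_integrability_of_sup_bound`, Kato's `L³` theory and the energy
equality being theorems (`ess_kato_L3_local_holds`, `galdi_energy_equality_holds`). Real proof.
[cite: EscauriazaSereginSverak2003, Thm. 1.3 (1.14), §3] -/
theorem ess_L5_integrability_of_noConcentration
    (hno : ∀ (v : ℝ → EuclideanSpace ℝ (Fin 3) → EuclideanSpace ℝ (Fin 3)) (p : ℝ → EuclideanSpace ℝ (Fin 3) → ℝ), IsL3inftyLocalPair 1 1 ((0 : ℝ), (0 : EuclideanSpace ℝ (Fin 3))) v p →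
      ∀ z ∈ closure (parabolicCylinder (1 / 2) ((0 : ℝ), (0 : EuclideanSpace ℝ (Fin 3)))), ∀ ε : ℝ, 0 < ε →
        ∃ r ∈ Ioc (0 : ℝ) (1 / 2), ENNReal.ofReal ((r ^ 2)⁻¹) *
          ∫⁻ w in parabolicCylinder r z, (‖v w.1 w.2‖ₑ ^ 3 + ‖p w.1 w.2‖ₑ ^ (3 / 2 : ℝ)) <
            ENNReal.ofReal ε) :
    ess_L5_integrability :=
  ess_L5_integrability_of_sup_bound (ess_sup_bound_of_noConcentration hno) ess_kato_L3_local_holds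
    galdi_energy_equality_holds

/-- **The endpoint criterion ns.S08 from the absence of points of concentration alone**
(Escauriaza–Seregin–Šverák 2003, Thm. 1.3 with uniqueness): `ess_endpoint` follows from `hno`
(as in `ess_sup_bound_of_noConcentration`) through the accepted `ess_endpoint_of_sup_bound_of_kato`,
Kato's `L³` theory, the energy equality and Ladyzhenskaya–Prodi–Serrin regularity being theorems
(`ess_kato_L3_local_holds`, `galdi_energy_equality_holds`, `ladyzhenskaya_prodi_serrin_holds`).
Real proof. [cite: EscauriazaSereginSverak2003, Thm. 1.3, §3] -/
theorem ess_endpoint_of_noConcentration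
    (hno : ∀ (v : ℝ → EuclideanSpace ℝ (Fin 3) → EuclideanSpace ℝ (Fin 3)) (p : ℝ → EuclideanSpace ℝ (Fin 3) → ℝ), IsL3inftyLocalPair 1 1 ((0 : ℝ), (0 : EuclideanSpace ℝ (Fin 3))) v p →
      ∀ z ∈ closure (parabolicCylinder (1 / 2) ((0 : ℝ), (0 : EuclideanSpace ℝ (Fin 3)))), ∀ ε : ℝ, 0 < ε →
        ∃ r ∈ Ioc (0 : ℝ) (1 / 2), ENNReal.ofReal ((r ^ 2)⁻¹) *
          ∫⁻ w in parabolicCylinder r z, (‖v w.1 w.2‖ₑ ^ 3 + ‖p w.1 w.2‖ₑ ^ (3 / 2 : ℝ)) <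
            ENNReal.ofReal ε) :
    ess_endpoint :=
  ess_endpoint_of_sup_bound_of_kato (ess_sup_bound_of_noConcentration hno) ess_kato_L3_local_holds
    galdi_energy_equality_holds ladyzhenskaya_prodi_serrin_holds

end Literature.Analysis.FluidPDE

end
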